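import Summits.ResolutionOfSingularities.ResolutionOfSingularities.Theorems.PurelyInseparableDim4WinCertLeafGcdConst
import Summits.ResolutionOfSingularities.ResolutionOfSingularities.Theorems.PurelyInseparableDim4ScopeBlindRationalMap
import HarnessLib
import HarnessLib.Audit.Tags

/-!
# Purely inseparable fourfolds — FCert v3 with STILL FLATS and rational-curve blind rows: the checker `lwinCertBLS`
# and its soundness over every field of characteristic `p`
# [OURS · counted 0 · a certificate format for OUR frame v4, not about resolution]

Census cell «res-dim4-pi» (D-0157 DOOR 2), desk WORD #164 (b) «∀K RESIDUE»; seat res-rescue-typ-3 g10 (rescue base,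
harness successor of g9).  Sequel of `…WinCertLeafSound` (FCert v3: `LRow`/`LCert`, `lrowOKL`, `lwinCertBL`,
`forall_inScopeStateWins_of_lwinCertBL`) and `…WinCertLeafGcdConst` (`leafOK5`).  Two changes to the ROW CHECK, both
with the landed conclusion shape verbatim:

* **blind rows** are accepted with EITHER of res-dim4-p-13's two blindness certificates — `.mono` (monomial curve,
  `blindB`, as before) or `.rat` (rational curve `xᵢ = Pᵢ(t)/D(t)^{vᵢ}`, `rblindB`; transfer to every `K ⊇ k` is
  `ScopeBlind.not_inCoordinateScope_map_of_rblindB`, ✓ `…ScopeBlindRationalMap`): `lblindOKS`;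
* **STILL FLATS**: a flat `Λ = {x_j = 0, x_t = b0_t (t ∉ U)}` of a move row whose base child `c = stepD q S j b0 s`
  mentions NO free coordinate (`noVarsB U c.L`: every listed exponent vanishes on `U`) is discharged by ANY later row of
  state `c` — a blind row, a non-`q`-fold row, or a move row with an arbitrary centre (`lbaseOKS`).  Reason
  (`step_add_F` + `translate_map_evalT_of_noVars`, from ✓ `…FlatAbsorbComm`): the child at `b0 + v`, `v` supported on
  `U`, has `F = clean (translate v c.F) = clean c.F = c.F` — B's translation along the flat does NOTHING, so every child
  on the flat IS the base child (`inScopeStateWins_congr`).  The old discharge (a move row with centre disjoint from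
  `U`, ✓ `…FlatAbsorb`) stays available.
Why: the last two 𝔽₂-pair-only band roots outside the ∀K column (COUNTS rev 19) funnel, under every cover option,
into base children that are OUT OF SCOPE (won for A at once) but which FCert v3 forces to MOVE with a centre avoiding
`U` — e.g. root S1a-d27403c158 reaches `x₄(x₃ + x₂^a + x₂^b x₃²)` (no `x₁`, `U = {x₁}`), whose only such centre is the
`x₁`-axis and whose descent regenerates `a + b ↦ 2(a + b)` for ever; with still flats that root has a 4-row certificate.

* §0 `noVarsB`, `lblindOKS`, `lbaseOKS`, `lflatsOKBS`, `lrowOKLS`, `lwinCertBLS`, block form `lwinCertBLS2` /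
  `lwinCertBLS_append_of`;
* §1 the two still-flat lemmas; §2 soundness of one row (`ledges_of_moveS`, `lrowGood_of_lrowOKS`); §3
  **`forall_inScopeStateWins_of_lwinCertBLS (hs : LeafSound p leafOK) (h : lwinCertBLS p p leafOK T = true)`** and the
  five-kind specialisation **`forall_inScopeStateWins_of_lwinCertBLS5`** (`leafOK5`, ✓ `leafSound5`).
Nothing here proves resolution of singularities in dimension ≥ 4 / characteristic `p`; F4-C(2,2) stays OPEN; the column
this feeds certifies `InScopeStateWins` on listed roots only.  Counted 0; AI work, weaker than expert review.
bears_on: LADDER-RESOLUTION:D157-DOOR2 (res-dim4-pi · F4-C ∀K column · FCert v3 still-flat checker).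
Supports stmt-ResolutionOfSingularities-16155 (helper).
-/

set_option linter.dupNamespace false

noncomputable section
open MvPolynomial Finset
open scoped BigOperators
namespace Summit.ResolutionOfSingularities.ResolutionOfSingularities.Theorems.PIDim4

namespace WinCertLeaf

open Literature.AlgebraicGeometry.Resolution
open Literature.AlgebraicGeometry.Resolution.Hauser2010
open Literature.AlgebraicGeometry.Resolution.CentreBlowup
open StepKit WinCertSound InScopeWinCert ScopeCover ScopeBlind WinCertAllFields FlatAbsorb WinCertFlat WinCertSubst

/-! ## 0. The checker with still flats -/

section Checker

variable {k : Type} [Field k] [DecidableEq k]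

variable {C : Type}

/-- **No listed exponent of `L` touches a coordinate of `U`.** [folklore] -/
def noVarsB (U : Finset (Fin 4)) (L : Terms 4 k) : Bool := decide (∀ t ∈ L, ∀ u ∈ U, t.1 u = 0)

/-- **A blindness certificate of the row passes**: `.mono` (`blindB`) or `.rat` (`rblindB`). [folklore] -/
def lblindOKS (q : ℕ) (row : LRow k C) : Bool :=
  match row.1.2.2 with
  | some (.mono c w α₀ a) => blindB q row.1.1 c w α₀ a
  | some (.rat P v D kk α₀ a) => rblindB q row.1.1 P v D kk α₀ a
  | none => false

variable [Fintype k]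

/-- **The base child of a flat is certified later**: by a MOVE avoiding the flat's free coordinates (as in FCert v3), OR
— when the base child mentions no free coordinate (a STILL flat) — by any later row of the same state. [folklore] -/
def lbaseOKS (q : ℕ) (rest : LCert k C) (c : SData 4 k) (U : Finset (Fin 4)) : Bool :=
  lbaseOK q rest c U || (noVarsB U c.L && rest.any fun r : LRow k C => c.equivB r.1.1)

/-- **Every flat sits in a chart of the centre, through a centre point, with its base child certified later** (still
form). [folklore] -/
def lflatsOKBS (q : ℕ) (rest : LCert k C) (s : SData 4 k) (S : Finset (Fin 4)) (flats : List (Flat k)) : Bool :=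
  decide (∀ φ ∈ flats, φ.j ∈ S ∧ φ.b0 φ.j = 0 ∧ lbaseOKS q rest (stepD q S φ.j φ.b0 s) φ.U = true)

/-- **The row check** with still flats and `.rat` blind rows, for a leaf oracle `leafOK`. [folklore] -/
def lrowOKLS (p q : ℕ) (leafOK : SData 4 k → Finset (Fin 4) → ILeaf k C → Bool) (rest : LCert k C)
    (row : LRow k C) : Bool :=
  lblindOKS q row || !(permB q Finset.univ row.1.1.L) ||
    (permB q row.1.2.1 row.1.1.L &&
      lrepliesOKB q rest row.1.1 row.1.2.1 row.2.2.1 row.2.2.2 &&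
      lflatsOKBS q rest row.1.1 row.1.2.1 row.2.2.1 &&
      lleavesOKB leafOK row.1.1 row.1.2.1 row.2.2.2 &&
      lcoversOKB p q row.1.1 row.1.2.1 row.2.1 row.2.2.1 row.2.2.2)

/-- **The checker** (still form). [folklore] -/
def lwinCertBLS (p q : ℕ) (leafOK : SData 4 k → Finset (Fin 4) → ILeaf k C → Bool) : LCert k C → Bool
  | [] => true
  | row :: rest => lrowOKLS p q leafOK rest row && lwinCertBLS p q leafOK rest

/-- **Block form of the checker**: the rows of `A` are checked against their tails inside `A ++ B`; `B` itself is not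
checked. [folklore] -/
def lwinCertBLS2 (p q : ℕ) (leafOK : SData 4 k → Finset (Fin 4) → ILeaf k C → Bool) : LCert k C → LCert k C → Bool
  | [], _ => true
  | row :: A, B => lrowOKLS p q leafOK (A ++ B) row && lwinCertBLS2 p q leafOK A B

/-- `lwinCertBLS (A ++ B)` splits into the block check of `A` over `B` and the check of `B`. [folklore] -/
theorem lwinCertBLS_append (p q : ℕ) (leafOK : SData 4 k → Finset (Fin 4) → ILeaf k C → Bool) : ∀ A B : LCert k C,
    lwinCertBLS p q leafOK (A ++ B) = (lwinCertBLS2 p q leafOK A B && lwinCertBLS p q leafOK B)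
  | [], B => by simp [lwinCertBLS2]
  | row :: A, B => by
    rw [List.cons_append, show lwinCertBLS p q leafOK (row :: (A ++ B)) =
      (lrowOKLS p q leafOK (A ++ B) row && lwinCertBLS p q leafOK (A ++ B)) from rfl,
      show lwinCertBLS2 p q leafOK (row :: A) B = (lrowOKLS p q leafOK (A ++ B) row && lwinCertBLS2 p q leafOK A B)
      from rfl, lwinCertBLS_append p q leafOK A B, Bool.and_assoc]

/-- Assembling a certificate check from a block check and the check of the tail. [folklore] -/
theorem lwinCertBLS_append_of (p q : ℕ) (leafOK : SData 4 k → Finset (Fin 4) → ILeaf k C → Bool) {A B : LCert k C}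
    (hA : lwinCertBLS2 p q leafOK A B = true) (hB : lwinCertBLS p q leafOK B = true) :
    lwinCertBLS p q leafOK (A ++ B) = true := by
  rw [lwinCertBLS_append, hA, hB, Bool.and_self]

omit [Field k] [DecidableEq k] [Fintype k] in
/-- Soundness of `noVarsB`. [folklore] -/
theorem forall_of_noVarsB {U : Finset (Fin 4)} {L : Terms 4 k} (h : noVarsB U L = true) :
    ∀ t ∈ L, ∀ u ∈ U, t.1 u = 0 := by
  unfold noVarsB at h
  exact of_decide_eq_true h

omit [Fintype k] in
/-- Soundness of `lbaseOKS`: the old discharge, or a still flat with some later row of the base child's state.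
[folklore] -/
theorem lbaseOKS_cases {q : ℕ} {rest : LCert k C} {c : SData 4 k} {U : Finset (Fin 4)}
    (h : lbaseOKS q rest c U = true) :
    lbaseOK q rest c U = true ∨
      ((∀ t ∈ c.L, ∀ u ∈ U, t.1 u = 0) ∧ ∃ r ∈ rest, c.toState = r.1.1.toState) := by
  unfold lbaseOKS at h
  rw [Bool.or_eq_true] at h
  rcases h with h | h
  · exact Or.inl h
  · rw [Bool.and_eq_true] at h
    obtain ⟨r, hr, hrc⟩ := List.any_eq_true.mp h.2
    exact Or.inr ⟨forall_of_noVarsB h.1, r, hr, (toState_eq_iff c r.1.1).mpr hrc⟩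

end Checker

/-! ## 1. Still flats: translating a polynomial along coordinates it does not mention -/

section Still

variable {k : Type} [Field k] {K : Type} [Field K]

/-- Translation `xᵢ ↦ xᵢ + vᵢ` fixes a monomial none of whose variables is moved. [folklore] -/
theorem aeval_translate_monomial_of_forall (v : Fin 4 → K) (d : Fin 4 →₀ ℕ) (c : K)
    (h : ∀ i ∈ d.support, v i = 0) :
    aeval (fun i => X i + C (v i)) (monomial d c) = monomial d c := by
  rw [aeval_monomial, algebraMap_eq, monomial_eq]
  congr 1
  exact Finsupp.prod_congr fun i hi => by rw [h i hi, map_zero, add_zero]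

/-- **Translation fixes a presented polynomial along coordinates none of whose listed exponents is non-zero.**
[folklore] -/
theorem translate_map_evalT_of_noVars (f : k →+* K) (v : Fin 4 → K) :
    ∀ L : Terms 4 k, (∀ t ∈ L, ∀ i, v i ≠ 0 → t.1 i = 0) →
      PointBlowup.translate v (MvPolynomial.map f (evalT L)) = MvPolynomial.map f (evalT L)
  | [], _ => by
    unfold PointBlowup.translate
    rw [evalT_nil, map_zero, map_zero]
  | t :: L, h => by
    have ht : ∀ i, v i ≠ 0 → t.1 i = 0 := h t List.mem_cons_self
    have hL : ∀ t' ∈ L, ∀ i, v i ≠ 0 → t'.1 i = 0 := fun t' ht' => h t' (List.mem_cons_of_mem _ ht')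
    have ih := translate_map_evalT_of_noVars f v L hL
    unfold PointBlowup.translate at ih ⊢
    rw [evalT_cons, map_add, map_add, ih, map_monomial, aeval_translate_monomial_of_forall v (expo t.1) (f t.2)]
    intro i hi
    by_contra hne
    rw [Finsupp.mem_support_iff, expo_apply] at hi
    exact hi (ht i hne)

variable [DecidableEq K] {p : ℕ} [Fact p.Prime] [CharP K p]

/-- **The step at a translated point**: `(step (b0 + v)).F = clean (translate v (step b0).F)`. [folklore] -/
theorem step_add_F (S : Finset (Fin 4)) (j : Fin 4) (b0 v : Fin 4 → K) (s : State K) :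
    (step p S j (b0 + v) s).F = deletePthPowers p (PointBlowup.translate v (step p S j b0 s).F) := by
  show deletePthPowers p (PointBlowup.translate (b0 + v) (chartTransform p S j s.F)) =
    deletePthPowers p (PointBlowup.translate v (deletePthPowers p (PointBlowup.translate b0 (chartTransform p S j s.F))))
  rw [deletePthPowers_translate_deletePthPowers, FlatAbsorb.translate_add]

omit [Fact p.Prime] [CharP K p] in
/-- The `F` of a step is clean. [folklore] -/
theorem deletePthPowers_step_F (S : Finset (Fin 4)) (j : Fin 4) (b : Fin 4 → K) (s : State K) :
    deletePthPowers p (step p S j b s).F = (step p S j b s).F := by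
  show deletePthPowers p (deletePthPowers p (PointBlowup.translate b (chartTransform p S j s.F))) = _
  exact PointBlowup.deletePthPowers_deletePthPowers p _

/-- **STILL FLAT**: if the base child `c` of the flat through `f ∘ b0` with free coordinates `U` (presented over `k`)
mentions no coordinate of `U`, then the child at every point `f ∘ b0 + v` of the flat has the SAME `F`. [folklore] -/
theorem step_add_F_eq_of_noVars (f : k →+* K) (S : Finset (Fin 4)) (j : Fin 4) {U : Finset (Fin 4)}
    {v : Fin 4 → K} (hv : ∀ t, t ∉ U → v t = 0) (b0 : Fin 4 → K) (s : State K) {c : SData 4 k}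
    (hc : (step p S j b0 s).F = MvPolynomial.map f (evalT c.L)) (hU : ∀ t ∈ c.L, ∀ u ∈ U, t.1 u = 0) :
    (step p S j (b0 + v) s).F = (step p S j b0 s).F := by
  have hL : ∀ t ∈ c.L, ∀ i, v i ≠ 0 → t.1 i = 0 := by
    intro t ht i hvi
    by_cases hiU : i ∈ U
    · exact hU t ht i hiU
    · exact absurd (hv i hiU) hvi
  rw [step_add_F, hc, translate_map_evalT_of_noVars f v c.L hL, ← hc, deletePthPowers_step_F]

end Still

/-! ## 2. Soundness of one row -/

variable {C : Type}

/-- **A good row** over `K` (as in `…WinCertLeafSound`, for the still checker): its state is in-scope escapable, and —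
if it is a non-blind `p`-fold row — its centre is permissible and every `K`-edge through its centre leads to an in-scope
escapable state. [folklore] -/
theorem ledges_of_moveS {p : ℕ} [Fact p.Prime] {K : Type} [Field K] [CharP K p] [DecidableEq K]
    (f : ZMod p →+* K) {leafOK : SData 4 (ZMod p) → Finset (Fin 4) → ILeaf (ZMod p) C → Bool}
    (hs : LeafSound p leafOK) {rest : LCert (ZMod p) C} (hrest : ∀ r ∈ rest, LRowGood f r) {row : LRow (ZMod p) C}
    (hall : lrepliesOKB p rest row.1.1 row.1.2.1 row.2.2.1 row.2.2.2 = true)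
    (hflats : lflatsOKBS p rest row.1.1 row.1.2.1 row.2.2.1 = true)
    (hleaves : lleavesOKB leafOK row.1.1 row.1.2.1 row.2.2.2 = true)
    (hcov : lcoversOKB p p row.1.1 row.1.2.1 row.2.1 row.2.2.1 row.2.2.2 = true) :
    ∀ t, Edge p row.1.2.1 (lrowState f row) t → InScopeStateWins p t := by
  classical
  unfold lrepliesOKB at hall
  unfold lflatsOKBS at hflats
  unfold lleavesOKB at hleaves
  unfold lcoversOKB at hcov
  have hall' := of_decide_eq_true hall
  have hflats' := of_decide_eq_true hflats
  have hleaves' := of_decide_eq_true hleaves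
  have hcov' := of_decide_eq_true hcov
  -- a flat of chart `j` absorbs every `K`-point on it
  have hflat : ∀ (j : Fin 4) (φ : Flat (ZMod p)), φ ∈ row.2.2.1 → φ.j = j → ∀ b : Fin 4 → K, OnFlat f φ b →
      InScopeStateWins p (step p row.1.2.1 j b (lrowState f row)) := by
    intro j φ hφ hφj b hb
    obtain ⟨-, -, hbase⟩ := hflats' φ hφ
    obtain ⟨v, hv, rfl⟩ := exists_add_of_onFlat f hb
    have hstep : step p row.1.2.1 j (f ∘ φ.b0) (lrowState f row) =
        ⟨MvPolynomial.map f (stepD p row.1.2.1 φ.j φ.b0 row.1.1).toState.F,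
          (stepD p row.1.2.1 φ.j φ.b0 row.1.1).toState.r, (stepD p row.1.2.1 φ.j φ.b0 row.1.1).toState.exc⟩ := by
      rw [lrowState, ← hφj, BaseChange.step_map f p row.1.2.1 φ.j φ.b0 row.1.1.toState, step_toState]
    rcases lbaseOKS_cases hbase with hbase | ⟨hU, r, hr, hrc⟩
    · -- FCert v3's discharge: a later MOVE row avoiding `U` (flat absorption)
      obtain ⟨r, hr, hrc, hnone, huniv, hpermr, hdisj⟩ := exists_of_lbaseOK hbase
      have hgood := (hrest r hr).2 hnone huniv
      have hF : (step p row.1.2.1 j (f ∘ φ.b0) (lrowState f row)).F = (lrowState f r).F := by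
        rw [hstep, lrowState, hrc]
      refine inScopeStateWins_step_add_of_move (S' := r.1.2.1) (fun i hi => hv i ?_) ?_ ?_
      · exact fun hiU => (Finset.disjoint_left.mp hdisj) hi hiU
      · rw [hF]; exact hgood.1
      · intro t ht
        obtain ⟨t', ht', hFt⟩ := edge_congr hF ht
        exact inScopeStateWins_congr (hgood.2 t' ht') t hFt
    · -- a STILL flat: the child at `f ∘ b0 + v` has the base child's `F`, certified by the later row `r`
      have hc : (step p row.1.2.1 j (f ∘ φ.b0) (lrowState f row)).F =
          MvPolynomial.map f (evalT (stepD p row.1.2.1 φ.j φ.b0 row.1.1).L) := by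
        rw [hstep, SData.toState_F]
      have hsame := step_add_F_eq_of_noVars f row.1.2.1 j hv (f ∘ φ.b0) (lrowState f row) hc hU
      have hF : (step p row.1.2.1 j (f ∘ φ.b0) (lrowState f row)).F = (lrowState f r).F := by
        rw [hstep, lrowState, hrc]
      exact inScopeStateWins_congr (hrest r hr).1 _ (by rw [hsame, hF])
  -- a leaf of chart `j` gives a blind child at every `K`-point on it
  have hleaf : ∀ (j : Fin 4) (ℓ : ILeaf (ZMod p) C), ℓ ∈ row.2.2.2 → ℓ.j = j → ∀ b : Fin 4 → K, b j = 0 →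
      OnLeaf f ℓ b → InScopeStateWins p (step p row.1.2.1 j b (lrowState f row)) := by
    intro j ℓ hℓ hℓj b hbj hb
    obtain ⟨-, hok⟩ := hleaves' ℓ hℓ
    refine inScopeStateWins_of_not_inCoordinateScope ?_
    rw [← hℓj]
    exact hs row.1.1 row.1.2.1 ℓ hok K f b (by rw [hℓj]; exact hbj) hb
  rintro s' ⟨j, b, hj, hbj, heq, hne, rfl⟩
  have h0 : ∀ φ : Flat (ZMod p), φ ∈ row.2.2.1 → φ.b0 φ.j = 0 := fun φ hφ => (hflats' φ hφ).2.1
  rcases rational_or_onFlat_or_onILeaf f (hcov' j hj) h0 hbj heq with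
    ⟨b₀, hb₀j, rfl⟩ | ⟨φ, hφ, hφj, hon⟩ | ⟨ℓ, hℓ, hℓj, hon⟩
  · -- a rational reply
    rcases hall' j hj b₀ hb₀j with h | ⟨φ, hφ, hφj, honB⟩ | ⟨ℓ, hℓ, hℓj, honB⟩
    · have heq₀ : IsEquimultiplePoint p row.1.2.1 j b₀ row.1.1.toState :=
        (BaseChange.isEquimultiplePoint_map_ringHom_iff f p row.1.2.1 j b₀ row.1.1.toState).mp heq
      have hstep := BaseChange.step_map f p row.1.2.1 j b₀ row.1.1.toState
      unfold ireplyOK at h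
      rw [Bool.or_eq_true, Bool.or_eq_true] at h
      rcases h with (h1 | h2) | h3
      · rw [Bool.not_eq_true', ← Bool.not_eq_true] at h1
        exact absurd ((isEquimultiplePoint_iff p row.1.2.1 j b₀ row.1.1).mp heq₀) h1
      · exfalso
        apply hne
        show (step p row.1.2.1 j (f ∘ b₀) (lrowState f row)).F = 0
        rw [lrowState, hstep]
        show MvPolynomial.map f (step p row.1.2.1 j b₀ row.1.1.toState).F = 0
        have hz : (step p row.1.2.1 j b₀ row.1.1.toState).F = 0 := by
          by_contra hnz
          have := (step_F_ne_zero_iff p row.1.2.1 j b₀ row.1.1).mp hnz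
          rw [h2] at this
          exact Bool.noConfusion this
        rw [hz, map_zero]
      · obtain ⟨r, hr, hrc⟩ := exists_of_ichildIn h3
        obtain ⟨ur, hur, rfl⟩ := List.mem_map.mp hr
        show InScopeStateWins p (step p row.1.2.1 j (f ∘ b₀) (lrowState f row))
        rw [lrowState, hstep, step_toState, hrc]
        exact (hrest ur hur).1
    · exact hflat j φ hφ hφj _ (onFlat_of_onFlatB f honB)
    · exact hleaf j ℓ hℓ hℓj _ (by rw [Function.comp_apply, hb₀j, map_zero]) (onLeaf_of_onLeafBL f honB)
  · exact hflat j φ hφ hφj b hon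
  · exact hleaf j ℓ hℓ hℓj b hbj hon

/-- **SOUNDNESS of one row over `K`** (still checker). [folklore] -/
theorem lrowGood_of_lrowOKS {p : ℕ} [Fact p.Prime] {K : Type} [Field K] [CharP K p] [DecidableEq K]
    (f : ZMod p →+* K) {leafOK : SData 4 (ZMod p) → Finset (Fin 4) → ILeaf (ZMod p) C → Bool}
    (hs : LeafSound p leafOK) {rest : LCert (ZMod p) C} (hrest : ∀ r ∈ rest, LRowGood f r) {row : LRow (ZMod p) C}
    (h : lrowOKLS p p leafOK rest row = true) : LRowGood f row := by
  classical
  unfold lrowOKLS at h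
  rw [Bool.or_eq_true, Bool.or_eq_true] at h
  have hmove : permB p row.1.2.1 row.1.1.L = true →
      lrepliesOKB p rest row.1.1 row.1.2.1 row.2.2.1 row.2.2.2 = true →
      lflatsOKBS p rest row.1.1 row.1.2.1 row.2.2.1 = true →
      lleavesOKB leafOK row.1.1 row.1.2.1 row.2.2.2 = true →
      lcoversOKB p p row.1.1 row.1.2.1 row.2.1 row.2.2.1 row.2.2.2 = true →
      IsPermissibleCentre p row.1.2.1 (lrowState f row).F ∧
        ∀ t, Edge p row.1.2.1 (lrowState f row) t → InScopeStateWins p t := by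
    intro hS hall hflats hleaves hcov
    have hperm : IsPermissibleCentre p row.1.2.1 row.1.1.toState.F :=
      (isPermissibleCentre_iff p row.1.2.1 row.1.1.L).mpr hS
    exact ⟨(BaseChange.isPermissibleCentre_map_iff f p row.1.2.1 _).mpr hperm,
      ledges_of_moveS f hs hrest hall hflats hleaves hcov⟩
  rcases h with (hb | ht) | hm
  · -- a blindness certificate (monomial or rational curve): blind over `K`; the second clause is vacuous
    have hsome : row.1.2.2 ≠ none := by
      unfold lblindOKS at hb
      obtain ⟨⟨s, S, oβ⟩, ws, fl, lv⟩ := row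
      rcases oβ with _ | ⟨c, w, α₀, a⟩ | ⟨P, v, D, kk, α₀, a⟩
      · exact absurd hb Bool.false_ne_true
      · exact Option.some_ne_none _
      · exact Option.some_ne_none _
    refine ⟨?_, fun hnone => absurd hnone hsome⟩
    unfold lblindOKS at hb
    obtain ⟨⟨s, S, oβ⟩, ws, fl, lv⟩ := row
    rcases oβ with _ | ⟨c, w, α₀, a⟩ | ⟨P, v, D, kk, α₀, a⟩
    · exact absurd hb Bool.false_ne_true
    · exact inScopeStateWins_of_not_inCoordinateScope (not_inCoordinateScope_map_of_blindB f hb)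
    · exact inScopeStateWins_of_not_inCoordinateScope (ScopeBlind.not_inCoordinateScope_map_of_rblindB (f := f) hb)
  · -- origin not `p`-fold; the second clause is vacuous
    rw [Bool.not_eq_true'] at ht
    constructor
    · refine inScopeStateWins_of_no_permissible fun S hS => ?_
      exact no_permissible_of_not_permB ht S ((BaseChange.isPermissibleCentre_map_iff f p S _).mp hS)
    · intro _ huniv
      rw [ht] at huniv
      exact absurd huniv Bool.false_ne_true
  · simp only [Bool.and_eq_true] at hm
    obtain ⟨⟨⟨⟨hS, hall⟩, hflats⟩, hleaves⟩, hcov⟩ := hm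
    have hm' := hmove hS hall hflats hleaves hcov
    exact ⟨inScopeStateWins_move row.1.2.1 hm'.1 hm'.2, fun _ _ => hm'⟩

/-! ## 3. Soundness of a certificate over every field of characteristic `p` -/

/-- **SOUNDNESS OVER EVERY FIELD OF CHARACTERISTIC `p`** (still checker): every row of a checked certificate is good
over `K`. [folklore] -/
theorem lrowGood_of_lwinCertBLS {p : ℕ} [Fact p.Prime] {K : Type} [Field K] [CharP K p] [DecidableEq K]
    (f : ZMod p →+* K) {leafOK : SData 4 (ZMod p) → Finset (Fin 4) → ILeaf (ZMod p) C → Bool}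
    (hs : LeafSound p leafOK) : ∀ {T : LCert (ZMod p) C}, lwinCertBLS p p leafOK T = true → ∀ row ∈ T, LRowGood f row
  | [], _ => fun row hrow => absurd hrow List.not_mem_nil
  | row :: rest, h => by
    unfold lwinCertBLS at h
    rw [Bool.and_eq_true] at h
    have hrest := lrowGood_of_lwinCertBLS f hs h.2
    intro r hr
    rcases List.mem_cons.mp hr with rfl | hr'
    · exact lrowGood_of_lrowOKS f hs hrest h.1
    · exact hrest r hr'

/-- **`∀ K` form**: for a SOUND leaf oracle and every field `K` of characteristic `p`, every row state `⊗ K` of a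
certificate passing the still checker is IN-SCOPE ESCAPABLE (`InScopeStateWins p`: the F4-C game at `(p, p)`, player B
ranging over ALL of `K⁴`). [folklore] -/
theorem forall_inScopeStateWins_of_lwinCertBLS {p : ℕ} [Fact p.Prime]
    {leafOK : SData 4 (ZMod p) → Finset (Fin 4) → ILeaf (ZMod p) C → Bool} (hs : LeafSound p leafOK)
    {T : LCert (ZMod p) C} (h : lwinCertBLS p p leafOK T = true) (K : Type) [Field K] [CharP K p] [DecidableEq K] :
    ∀ row ∈ T, InScopeStateWins p
      (⟨MvPolynomial.map (ZMod.castHom (dvd_refl p) K) row.1.1.toState.F, row.1.1.toState.r,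
        row.1.1.toState.exc⟩ : State K) :=
  fun row hrow => (lrowGood_of_lwinCertBLS (ZMod.castHom (dvd_refl p) K) hs h row hrow).1

/-- **`∀ K` form for the five leaf kinds** (`leafOK5`, ✓ `leafSound5`) with still flats and `.rat` blind rows.
[folklore] -/
theorem forall_inScopeStateWins_of_lwinCertBLS5 {T : LCert (ZMod 2) (LeafCert5 (ZMod 2))}
    (h : lwinCertBLS 2 2 leafOK5 T = true) (K : Type) [Field K] [CharP K 2] [DecidableEq K] :
    ∀ row ∈ T, InScopeStateWins 2
      (⟨MvPolynomial.map (ZMod.castHom (dvd_refl 2) K) row.1.1.toState.F, row.1.1.toState.r,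
        row.1.1.toState.exc⟩ : State K) :=
  forall_inScopeStateWins_of_lwinCertBLS leafSound5 h K

end WinCertLeaf

end Summit.ResolutionOfSingularities.ResolutionOfSingularities.Theorems.PIDim4

end
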